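import Summits.AtomisticToContinuum.BoseEinsteinCondensation.Theorems.BECDyadicChainingDyadicCoherenceDefectLevelIncrement
import Literature.MathematicalPhysics.QuantumManyBody.DyadicCoherentFractionLimit
import HarnessLib

/-!
# Route `BECDyadicChaining` — crux `DyadicCoherenceDefect`, stub `stub_defectPerturbation` (DP)

Perturbation of the coherence defect of the dyadic block condensates: for a Dirichlet trial state
`Ψ ∈ TrialState N L`, `α ∈ ℂ` and a level `m ≥ 1`, `A_m(Ψ) ≤ A_{m-1}(Ψ) + 2 (N ∫ |Ψ - α Ψ₀|²)^{1/2}`,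
where `A_m = 8^{-m/2} ∑_{C ∈ level m} ⟨φ_C, γ_Ψ φ_C⟩^{1/2}` is the coherent amplitude of the flat modes
of the `8^m` open dyadic cubes of side `L/2^m` and `Ψ₀ = 1_{Λ^N} ∏∏ √(2/L) sin(π X_{ik}/L)` is the
free Dirichlet product ground state.

Proof (Hilbert-space geometry over `occupation`): `⟨φ, γ_F φ⟩^{1/2} = √N ‖u_φ(F)‖_{L²(dY)}` with the
Gram vector `u_φ(F)(Y) = ∫ conj φ(x) F(x, Y) dx` (`rpow_half_occupation_succ`). The Gram vectors are
linear in `F` (integrable slices), those of `Ψ₀` are non-negative real multiples `κ_C g` of ONE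
function (`Ψ₀(x, Y) = ψ₁(x) g(Y)`, `ψ₁ ≥ 0`), and for a parent cube `P` with children `C_c`,
`∑_c u_{C_c}(Ψ) = √8 u_P(Ψ)`; two triangle inequalities in `L²(dY)` give
`∑_c ‖u_{C_c}(Ψ)‖ ≤ √8 ‖u_P(Ψ)‖ + 2 ∑_c ‖u_{C_c}(Ψ - α Ψ₀)‖`. Summing over parents, Cauchy–Schwarz over
the `8^{k+1}` cells and the Bessel bound `cohSum_le_mul_lintegral` finish; the open cubes are a.e. the
half-open cells (`openCell_ae_eq_dyCell`). No new definitions.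
-/

noncomputable section

namespace Summit.AtomisticToContinuum.BoseEinsteinCondensation.Cruxes.DyadicCoherenceDefect.Birth

open Filter MeasureTheory
open scoped ENNReal NNReal BigOperators ComplexConjugate
open Literature.MathematicalPhysics.QuantumManyBody.BoseGas
open Summit.AtomisticToContinuum.BoseEinsteinCondensation.Theses
open Summit.AtomisticToContinuum.BoseEinsteinCondensation.Theorems

namespace DefectPerturbation

variable {n : ℕ} {L : ℝ}

/-! ### `L²` geometry -/

/-- **Triangle inequalities in `L²`.** If `u_c = (α κ_c) • g + w_c` with real `κ_c ≥ 0`, then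
`∑_c ‖u_c‖₂ ≤ ‖∑_c u_c‖₂ + 2 ∑_c ‖w_c‖₂`: indeed `∑_c ‖u_c‖ ≤ ‖α‖ (∑_c κ_c) ‖g‖ + ∑_c ‖w_c‖` and
`‖α‖ (∑_c κ_c) ‖g‖ = ‖∑_c u_c - ∑_c w_c‖ ≤ ‖∑_c u_c‖ + ∑_c ‖w_c‖`. [folklore] -/
theorem sum_eLpNorm_le_of_collinear {X ι : Type*} [MeasurableSpace X] [Fintype ι] {μ : Measure X}
    {g : X → ℂ} {u w : ι → X → ℂ} (hg : AEStronglyMeasurable g μ)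
    (hw : ∀ c, AEStronglyMeasurable (w c) μ) (α : ℂ) {κ : ι → ℝ} (hκ : ∀ c, 0 ≤ κ c)
    (hu : ∀ c, u c = (α * κ c) • g + w c) :
    ∑ c, eLpNorm' (u c) 2 μ ≤ eLpNorm' (∑ c, u c) 2 μ + 2 * ∑ c, eLpNorm' (w c) 2 μ := by
  have h1 : (1 : ℝ) ≤ 2 := by norm_num
  have h0 : (0 : ℝ) < 2 := by norm_num
  have hum : ∀ c, AEStronglyMeasurable (u c) μ := fun c => by
    rw [hu c]; exact (hg.const_smul _).add (hw c)
  have hreal : ∀ r : ℝ, 0 ≤ r → ‖(r : ℂ)‖ₑ = ENNReal.ofReal r := fun r hr => by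
    rw [← ofReal_norm, Complex.norm_real, Real.norm_of_nonneg hr]
  have hκsum : ∑ c, ‖α * (κ c : ℂ)‖ₑ = ‖α * ((∑ c, κ c : ℝ) : ℂ)‖ₑ := by
    simp only [enorm_mul]
    rw [← Finset.mul_sum, hreal _ (Finset.sum_nonneg fun c _ => hκ c),
      ENNReal.ofReal_sum_of_nonneg fun c _ => hκ c]
    exact congrArg _ (Finset.sum_congr rfl fun c _ => hreal _ (hκ c))
  have hdec : ∑ c, u c = (α * ((∑ c, κ c : ℝ) : ℂ)) • g + ∑ c, w c := by
    simp only [hu, Finset.sum_add_distrib, ← Finset.sum_smul, Complex.ofReal_sum, Finset.mul_sum]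
  have hsub : (α * ((∑ c, κ c : ℝ) : ℂ)) • g = ∑ c, u c + -∑ c, w c := by
    rw [hdec, add_neg_cancel_right]
  calc ∑ c, eLpNorm' (u c) 2 μ
      ≤ ∑ c, (‖α * (κ c : ℂ)‖ₑ * eLpNorm' g 2 μ + eLpNorm' (w c) 2 μ) :=
        Finset.sum_le_sum fun c _ => by
          rw [hu c, ← eLpNorm'_const_smul _ h0]
          exact eLpNorm'_add_le (hg.const_smul _) (hw c) h1
    _ = ‖α * ((∑ c, κ c : ℝ) : ℂ)‖ₑ * eLpNorm' g 2 μ + ∑ c, eLpNorm' (w c) 2 μ := by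
        rw [Finset.sum_add_distrib, ← Finset.sum_mul, hκsum]
    _ = eLpNorm' (∑ c, u c + -∑ c, w c) 2 μ + ∑ c, eLpNorm' (w c) 2 μ := by
        rw [← hsub, eLpNorm'_const_smul _ h0]
    _ ≤ (eLpNorm' (∑ c, u c) 2 μ + eLpNorm' (-∑ c, w c) 2 μ) + ∑ c, eLpNorm' (w c) 2 μ := by
        gcongr
        exact eLpNorm'_add_le (Finset.aestronglyMeasurable_sum _ fun c _ => hum c)
          (Finset.aestronglyMeasurable_sum _ fun c _ => hw c).neg h1
    _ ≤ (eLpNorm' (∑ c, u c) 2 μ + ∑ c, eLpNorm' (w c) 2 μ) + ∑ c, eLpNorm' (w c) 2 μ := by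
        rw [eLpNorm'_neg]
        gcongr
        exact eLpNorm'_sum_le (fun c _ => hw c) h1
    _ = _ := by rw [two_mul, add_assoc]

/-! ### Gram vectors: slices, linearity, the eight children -/

/-- The one-particle slices `x ↦ Ψ(x, Y)` of a Dirichlet trial state are integrable (continuous,
supported in the bounded box). [folklore] -/
theorem integrable_slice (Ψ : TrialState (n + 1) L) (Y : Config n) :
    Integrable fun x : Space => Ψ.ψ (Matrix.vecCons x Y) := by
  refine (Ψ.contDiff.continuous.comp (by fun_prop)).integrable_of_hasCompactSupport ?_
  refine HasCompactSupport.intro (isCompact_closedBall (0 : Space) (2 * L)) fun x hx => ?_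
  exact Ψ.eq_zero _ fun hX => hx (box_subset_closedBall L (hX 0))

/-- **Linearity of the Gram vector** in the wave function (integrable slices):
`u_φ(F - α F₀) = u_φ(F) - α u_φ(F₀)` for a flat mode `φ`. [folklore] -/
theorem gram_dyMode_sub (L' : ℝ) (l : ℕ) (j : Fin 3 → Fin (2 ^ l)) {F F₀ : Config (n + 1) → ℂ}
    (α : ℂ) (Y : Config n) (hF : Integrable fun x => F (Matrix.vecCons x Y))
    (hF₀ : Integrable fun x => F₀ (Matrix.vecCons x Y)) :
    ∫ x, conj (dyMode L' l j x) * (F (Matrix.vecCons x Y) - α * F₀ (Matrix.vecCons x Y)) =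
      (∫ x, conj (dyMode L' l j x) * F (Matrix.vecCons x Y)) -
        α * ∫ x, conj (dyMode L' l j x) * F₀ (Matrix.vecCons x Y) := by
  simp only [integral_conj_dyMode_mul]
  rw [integral_sub hF.integrableOn (hF₀.const_mul α).integrableOn, integral_const_mul]
  ring

/-- **The children's Gram vectors sum to `√8` times the parent's** (pointwise in `Y`): for `f`
integrable on the parent cell, `∑_c ∫ conj(φ_{C_c}) f = √8 ∫ conj(φ_P) f`, since `∫_P = ∑_c ∫_{C_c}`
and `((s/2)³)^{-1/2} = √8 (s³)^{-1/2}`. [folklore] -/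
theorem sum_gram_dyChild (hL : 0 < L) (k : ℕ) (P : Fin 3 → Fin (2 ^ k)) {f : Space → ℂ}
    (hf : IntegrableOn f (dyCell L k P)) :
    ∑ c, ∫ x, conj (dyMode L (k + 1) (dyChild P c) x) * f x =
      ((Real.sqrt 8 : ℝ) : ℂ) * ∫ x, conj (dyMode L k P x) * f x := by
  simp only [integral_conj_dyMode_mul, side_succ L k]
  rw [setIntegral_dyCell_eq_sum_dyChild P hf, Finset.mul_sum, Finset.mul_sum]
  refine Finset.sum_congr rfl fun c _ => ?_
  rw [← mul_assoc]
  congr 1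
  have hs : 0 ≤ (L / 2 ^ k) ^ 3 := by positivity
  rw [← Complex.ofReal_inv, ← Complex.ofReal_inv, ← Complex.ofReal_mul]
  congr 1
  rw [show (L / 2 ^ k / 2) ^ 3 = (L / 2 ^ k) ^ 3 / 8 by ring, Real.sqrt_div hs, inv_div,
    div_eq_mul_inv]

/-! ### The product state: factorised slices, collinear non-negative Gram vectors -/

/-- **Factorisation of the slices of a product state**: `Ψ₀(x, Y) = ψ₁(x) · g(Y)` for
`Ψ₀ = 1_{Λ^{n+1}} ∏_i ∏_q χ(X_{iq})`, with `ψ₁ = 1_Λ ∏_q χ(x_q)` and `g = 1_{Λ^n} ∏_i ∏_q χ(Y_{iq})`.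
[folklore] -/
theorem prodState_vecCons (χ : ℝ → ℝ) (L : ℝ) (x : Space) (Y : Config n) :
    (boxN (n + 1) L).indicator (fun X : Config (n + 1) => ∏ i, ∏ q, ((χ (X i q) : ℝ) : ℂ))
        (Matrix.vecCons x Y) =
      (box L).indicator (fun x : Space => ∏ q, ((χ (x q) : ℝ) : ℂ)) x *
        (boxN n L).indicator (fun Y : Config n => ∏ i, ∏ q, ((χ (Y i q) : ℝ) : ℂ)) Y := by
  have hmem : (Matrix.vecCons x Y : Config (n + 1)) ∈ boxN (n + 1) L ↔ x ∈ box L ∧ Y ∈ boxN n L := by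
    simp only [boxN, Set.mem_setOf_eq, Fin.forall_fin_succ, Matrix.cons_val_zero, Matrix.cons_val_succ]
  have hprod : (∏ i : Fin (n + 1), ∏ q, ((χ ((Matrix.vecCons x Y : Config (n + 1)) i q) : ℝ) : ℂ)) =
      (∏ q, ((χ (x q) : ℝ) : ℂ)) * ∏ i : Fin n, ∏ q, ((χ (Y i q) : ℝ) : ℂ) := by
    rw [Fin.prod_univ_succ]; simp only [Matrix.cons_val_zero, Matrix.cons_val_succ]
  by_cases hx : x ∈ box L
  · by_cases hY : Y ∈ boxN n L
    · rw [Set.indicator_of_mem (hmem.2 ⟨hx, hY⟩), Set.indicator_of_mem hx, Set.indicator_of_mem hY,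
        hprod]
    · rw [Set.indicator_of_notMem (fun h => hY (hmem.1 h).2), Set.indicator_of_notMem hY, mul_zero]
  · rw [Set.indicator_of_notMem (fun h => hx (hmem.1 h).1), Set.indicator_of_notMem hx, zero_mul]

/-- The pairing of a flat mode with a NON-NEGATIVE real one-particle function is a non-negative real
number. [folklore] -/
theorem gram_dyMode_ofReal_nonneg (L : ℝ) (l : ℕ) (j : Fin 3 → Fin (2 ^ l)) {f : Space → ℝ}
    (hf : ∀ x, 0 ≤ f x) :
    ∃ r : ℝ, 0 ≤ r ∧ ∫ x, conj (dyMode L l j x) * ((f x : ℝ) : ℂ) = (r : ℂ) := by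
  refine ⟨(Real.sqrt ((L / 2 ^ l) ^ 3))⁻¹ * ∫ x in dyCell L l j, f x,
    mul_nonneg (inv_nonneg.2 (Real.sqrt_nonneg _)) (integral_nonneg hf), ?_⟩
  rw [integral_conj_dyMode_mul, integral_complex_ofReal, Complex.ofReal_mul, Complex.ofReal_inv]

/-- **The product state `Ψ₀ = 1_{Λ^{n+1}} ∏∏ χ` for a continuous profile `χ ≥ 0` on `(0, L)`**: its
bath factor `g` is measurable, `Ψ₀` is measurable, its slices are integrable, and its Gram vectors
against the flat modes of one level are non-negative real multiples `κ_C g` of `g`. [folklore] -/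
theorem prodState_gram (L : ℝ) {χ : ℝ → ℝ} (hχ : Continuous χ) (hχ0 : ∀ t ∈ Set.Ioo 0 L, 0 ≤ χ t)
    (l : ℕ) :
    AEStronglyMeasurable ((boxN n L).indicator fun Y : Config n => ∏ i, ∏ q, ((χ (Y i q) : ℝ) : ℂ))
        volume ∧
      Measurable ((boxN (n + 1) L).indicator fun X : Config (n + 1) => ∏ i, ∏ q, ((χ (X i q) : ℝ) : ℂ)) ∧
      (∀ Y : Config n, Integrable fun x : Space =>
        (boxN (n + 1) L).indicator (fun X : Config (n + 1) => ∏ i, ∏ q, ((χ (X i q) : ℝ) : ℂ))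
          (Matrix.vecCons x Y)) ∧
      ∀ j : Fin 3 → Fin (2 ^ l), ∃ κ : ℝ, 0 ≤ κ ∧
        (fun Y : Config n => ∫ x, conj (dyMode L l j x) *
            (boxN (n + 1) L).indicator (fun X : Config (n + 1) => ∏ i, ∏ q, ((χ (X i q) : ℝ) : ℂ))
              (Matrix.vecCons x Y)) =
          (κ : ℂ) • (boxN n L).indicator fun Y : Config n => ∏ i, ∏ q, ((χ (Y i q) : ℝ) : ℂ) := by
  have hp1 : Continuous fun x : Space => ∏ q, ((χ (x q) : ℝ) : ℂ) := by fun_prop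
  have hψ₁ : Integrable ((box L).indicator fun x : Space => ∏ q, ((χ (x q) : ℝ) : ℂ)) :=
    (integrable_indicator_iff (measurableSet_box L)).2
      ((hp1.continuousOn.integrableOn_compact (isCompact_closedBall (0 : Space) (2 * L))).mono_set
        (box_subset_closedBall L))
  have hofReal : ∀ x, (box L).indicator (fun x : Space => ∏ q, ((χ (x q) : ℝ) : ℂ)) x =
      (((box L).indicator (fun x : Space => ∏ q, χ (x q)) x : ℝ) : ℂ) := fun x => by
    by_cases hx : x ∈ box L
    · simp only [Set.indicator_of_mem hx, Complex.ofReal_prod]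
    · simp only [Set.indicator_of_notMem hx, Complex.ofReal_zero]
  have hnn : ∀ x, 0 ≤ (box L).indicator (fun x : Space => ∏ q, χ (x q)) x := fun x =>
    Set.indicator_apply_nonneg fun hx => Finset.prod_nonneg fun q _ => hχ0 _ (hx q)
  refine ⟨?_, ?_, fun Y => ?_, fun j => ?_⟩
  · exact ((show Continuous fun Y : Config n => ∏ i, ∏ q, ((χ (Y i q) : ℝ) : ℂ) by
      fun_prop).measurable.indicator (measurableSet_boxN n L)).aestronglyMeasurable
  · exact (show Continuous fun X : Config (n + 1) => ∏ i, ∏ q, ((χ (X i q) : ℝ) : ℂ) by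
      fun_prop).measurable.indicator (measurableSet_boxN (n + 1) L)
  · simp_rw [prodState_vecCons]
    exact hψ₁.mul_const _
  · obtain ⟨r, hr, hreq⟩ := gram_dyMode_ofReal_nonneg L l j hnn
    refine ⟨r, hr, funext fun Y => ?_⟩
    simp_rw [prodState_vecCons, ← mul_assoc]
    rw [integral_mul_const, Pi.smul_apply, smul_eq_mul]
    congr 1; simp_rw [hofReal]; exact hreq

/-! ### One parent against its eight children -/

/-- **Per-parent bound in `L²(dY)`.** For `L > 0`, a parent cell `P` of level `k` with children `C_c`,
a Dirichlet trial state `Ψ`, `α ∈ ℂ`, and a measurable `Ψ₀` with integrable slices whose level-`k+1`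
Gram vectors are non-negative real multiples of one function `g`:
`∑_c ‖u_{C_c}(Ψ)‖ ≤ √8 ‖u_P(Ψ)‖ + 2 ∑_c ‖u_{C_c}(Ψ - α Ψ₀)‖`. [folklore] -/
theorem sum_eLpNorm_gram_dyChild_le (hL : 0 < L) (k : ℕ) (P : Fin 3 → Fin (2 ^ k))
    (Ψ : TrialState (n + 1) L) (α : ℂ) {Ψ₀ : Config (n + 1) → ℂ} {G : Config n → ℂ}
    (hG : AEStronglyMeasurable G volume) (hΨ₀m : Measurable Ψ₀)
    (hΨ₀i : ∀ Y, Integrable fun x => Ψ₀ (Matrix.vecCons x Y))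
    (hΨ₀G : ∀ j : Fin 3 → Fin (2 ^ (k + 1)), ∃ κ : ℝ, 0 ≤ κ ∧
      (fun Y => ∫ x, conj (dyMode L (k + 1) j x) * Ψ₀ (Matrix.vecCons x Y)) = (κ : ℂ) • G) :
    ∑ c, eLpNorm' (fun Y => ∫ x, conj (dyMode L (k + 1) (dyChild P c) x) *
        Ψ.ψ (Matrix.vecCons x Y)) 2 volume ≤
      (8 : ℝ≥0∞) ^ (1 / 2 : ℝ) *
          eLpNorm' (fun Y => ∫ x, conj (dyMode L k P x) * Ψ.ψ (Matrix.vecCons x Y)) 2 volume +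
        2 * ∑ c, eLpNorm' (fun Y => ∫ x, conj (dyMode L (k + 1) (dyChild P c) x) *
          (Ψ.ψ (Matrix.vecCons x Y) - α * Ψ₀ (Matrix.vecCons x Y))) 2 volume := by
  have hΨi : ∀ Y, Integrable fun x => Ψ.ψ (Matrix.vecCons x Y) := integrable_slice Ψ
  have hWm : Measurable fun X => Ψ.ψ X - α * Ψ₀ X :=
    Ψ.contDiff.continuous.measurable.sub (hΨ₀m.const_mul α)
  choose κ hκ hκG using fun c : Fin 3 → Fin 2 => hΨ₀G (dyChild P c)
  -- the decomposition `u_c(Ψ) = (α κ_c) • g + u_c(W)`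
  have hdec : ∀ c, (fun Y => ∫ x, conj (dyMode L (k + 1) (dyChild P c) x) *
      Ψ.ψ (Matrix.vecCons x Y)) = (α * κ c) • G + fun Y => ∫ x,
        conj (dyMode L (k + 1) (dyChild P c) x) *
          (Ψ.ψ (Matrix.vecCons x Y) - α * Ψ₀ (Matrix.vecCons x Y)) := by
    intro c
    funext Y
    have hY := congrFun (hκG c) Y
    simp only [Pi.add_apply, Pi.smul_apply, smul_eq_mul] at hY ⊢
    rw [gram_dyMode_sub L (k + 1) (dyChild P c) α Y (hΨi Y) (hΨ₀i Y), hY]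
    ring
  -- the children's Gram vectors of `Ψ` sum to `√8` times the parent's
  have hsum : (∑ c, fun Y => ∫ x, conj (dyMode L (k + 1) (dyChild P c) x) *
      Ψ.ψ (Matrix.vecCons x Y)) =
        ((Real.sqrt 8 : ℝ) : ℂ) • fun Y => ∫ x, conj (dyMode L k P x) * Ψ.ψ (Matrix.vecCons x Y) := by
    funext Y
    rw [Finset.sum_apply, Pi.smul_apply, smul_eq_mul]
    exact sum_gram_dyChild hL k P (hΨi Y).integrableOn
  have hwm : ∀ c, AEStronglyMeasurable (fun Y => ∫ x, conj (dyMode L (k + 1) (dyChild P c) x) *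
      (Ψ.ψ (Matrix.vecCons x Y) - α * Ψ₀ (Matrix.vecCons x Y))) volume := fun c => by
    simp only [integral_conj_dyMode_mul]
    exact ((measurable_setIntegral_vecCons hWm _).const_mul _).aestronglyMeasurable
  refine (sum_eLpNorm_le_of_collinear hG hwm α hκ hdec).trans_eq ?_
  rw [hsum, eLpNorm'_const_smul _ (by norm_num : (0 : ℝ) < 2), ← ofReal_norm, Complex.norm_real,
    Real.norm_of_nonneg (Real.sqrt_nonneg _), Real.sqrt_eq_rpow,
    ← ENNReal.ofReal_rpow_of_pos (by norm_num : (0 : ℝ) < 8), ENNReal.ofReal_ofNat]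

/-- **Per-parent bound for the occupations.** With `W = Ψ - α Ψ₀`:
`∑_c ⟨φ_{C_c}, γ_Ψ φ_{C_c}⟩^{1/2} ≤ 8^{1/2} ⟨φ_P, γ_Ψ φ_P⟩^{1/2} + 2 ∑_c ⟨φ_{C_c}, γ_W φ_{C_c}⟩^{1/2}`
(`⟨φ, γ_F φ⟩^{1/2} = √N ‖u_φ(F)‖`). [cite: LSSY2005, §1.2 (1.17)] -/
theorem sum_rpow_half_occupation_dyChild_le (hL : 0 < L) (k : ℕ) (P : Fin 3 → Fin (2 ^ k))
    (Ψ : TrialState (n + 1) L) (α : ℂ) {Ψ₀ : Config (n + 1) → ℂ} {G : Config n → ℂ}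
    (hG : AEStronglyMeasurable G volume) (hΨ₀m : Measurable Ψ₀)
    (hΨ₀i : ∀ Y, Integrable fun x => Ψ₀ (Matrix.vecCons x Y))
    (hΨ₀G : ∀ j : Fin 3 → Fin (2 ^ (k + 1)), ∃ κ : ℝ, 0 ≤ κ ∧
      (fun Y => ∫ x, conj (dyMode L (k + 1) j x) * Ψ₀ (Matrix.vecCons x Y)) = (κ : ℂ) • G) :
    ∑ c, (occupation (n + 1) (dyMode L (k + 1) (dyChild P c)) Ψ.ψ) ^ (1 / 2 : ℝ) ≤
      (8 : ℝ≥0∞) ^ (1 / 2 : ℝ) * (occupation (n + 1) (dyMode L k P) Ψ.ψ) ^ (1 / 2 : ℝ) +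
        2 * ∑ c, (occupation (n + 1) (dyMode L (k + 1) (dyChild P c))
          (fun X => Ψ.ψ X - α * Ψ₀ X)) ^ (1 / 2 : ℝ) := by
  simp only [CoherentAmplitudeMonotone.rpow_half_occupation_succ, ← Finset.mul_sum]
  rw [mul_left_comm ((8 : ℝ≥0∞) ^ (1 / 2 : ℝ)) (((n : ℝ≥0∞) + 1) ^ (1 / 2 : ℝ)),
    mul_left_comm (2 : ℝ≥0∞) (((n : ℝ≥0∞) + 1) ^ (1 / 2 : ℝ)), ← mul_add]
  gcongr
  exact sum_eLpNorm_gram_dyChild_le hL k P Ψ α hG hΨ₀m hΨ₀i hΨ₀G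

/-! ### Summing over the parents -/

/-- **Level bookkeeping.** If for every parent `P` of level `k`
`∑_c x_{C_c}^{1/2} ≤ 8^{1/2} y_P^{1/2} + 2 ∑_c z_{C_c}^{1/2}`, then
`8^{-(k+1)/2} ∑_i x_i^{1/2} ≤ 8^{-k/2} ∑_P y_P^{1/2} + 2 (∑_i z_i)^{1/2}` (reindex level `k+1` by parents and
children, and Cauchy–Schwarz `∑_i z_i^{1/2} ≤ (8^{k+1})^{1/2} (∑_i z_i)^{1/2}`). [folklore] -/
theorem amplitude_succ_le_of_parent_bound (k : ℕ) (x z : (Fin 3 → Fin (2 ^ (k + 1))) → ℝ≥0∞)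
    (y : (Fin 3 → Fin (2 ^ k)) → ℝ≥0∞)
    (hP : ∀ P, ∑ c, (x (dyChild P c)) ^ (1 / 2 : ℝ) ≤
      (8 : ℝ≥0∞) ^ (1 / 2 : ℝ) * (y P) ^ (1 / 2 : ℝ) + 2 * ∑ c, (z (dyChild P c)) ^ (1 / 2 : ℝ)) :
    (8 : ℝ≥0∞) ^ (-((k + 1 : ℕ) : ℝ) / 2) * ∑ i, (x i) ^ (1 / 2 : ℝ) ≤
      (8 : ℝ≥0∞) ^ (-(k : ℝ) / 2) * ∑ P, (y P) ^ (1 / 2 : ℝ) + 2 * (∑ i, z i) ^ (1 / 2 : ℝ) := by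
  have h8 : (8 : ℝ≥0∞) ^ (-((k + 1 : ℕ) : ℝ) / 2) * (8 : ℝ≥0∞) ^ (1 / 2 : ℝ) =
      (8 : ℝ≥0∞) ^ (-(k : ℝ) / 2) := by
    rw [← ENNReal.rpow_add _ _ (by norm_num) (by simp)]
    congr 1; push_cast; ring
  have hcard : (Fintype.card (Fin 3 → Fin (2 ^ (k + 1))) : ℝ≥0∞) ^ (1 / 2 : ℝ) =
      (8 : ℝ≥0∞) ^ (((k + 1 : ℕ) : ℝ) / 2) := by
    rw [card_dyIndex, Nat.cast_pow, Nat.cast_ofNat, ← ENNReal.rpow_natCast, ← ENNReal.rpow_mul]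
    congr 1; ring
  have h1 : (8 : ℝ≥0∞) ^ (-((k + 1 : ℕ) : ℝ) / 2) * (8 : ℝ≥0∞) ^ (((k + 1 : ℕ) : ℝ) / 2) = 1 := by
    rw [← ENNReal.rpow_add _ _ (by norm_num) (by simp), ← ENNReal.rpow_zero (x := 8)]
    congr 1; ring
  have hz : ∑ i, (z i) ^ (1 / 2 : ℝ) ≤
      (8 : ℝ≥0∞) ^ (((k + 1 : ℕ) : ℝ) / 2) * (∑ i, z i) ^ (1 / 2 : ℝ) := by
    simpa only [hcard] using LevelIncrement.sum_rpow_half_le z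
  have h2 : (8 : ℝ≥0∞) ^ (-((k + 1 : ℕ) : ℝ) / 2) * (2 * ∑ i, (z i) ^ (1 / 2 : ℝ)) ≤
      2 * (∑ i, z i) ^ (1 / 2 : ℝ) :=
    calc _ ≤ (8 : ℝ≥0∞) ^ (-((k + 1 : ℕ) : ℝ) / 2) *
          (2 * ((8 : ℝ≥0∞) ^ (((k + 1 : ℕ) : ℝ) / 2) * (∑ i, z i) ^ (1 / 2 : ℝ))) := by gcongr
      _ = _ := by
          rw [mul_left_comm _ (2 : ℝ≥0∞), ← mul_assoc _ _ ((∑ i, z i) ^ (1 / 2 : ℝ)), h1, one_mul]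
  calc (8 : ℝ≥0∞) ^ (-((k + 1 : ℕ) : ℝ) / 2) * ∑ i, (x i) ^ (1 / 2 : ℝ)
      = (8 : ℝ≥0∞) ^ (-((k + 1 : ℕ) : ℝ) / 2) * ∑ P, ∑ c, (x (dyChild P c)) ^ (1 / 2 : ℝ) := by
        rw [LevelIncrement.sum_dyLevel_succ k fun i => (x i) ^ (1 / 2 : ℝ)]
    _ ≤ (8 : ℝ≥0∞) ^ (-((k + 1 : ℕ) : ℝ) / 2) * ∑ P, ((8 : ℝ≥0∞) ^ (1 / 2 : ℝ) * (y P) ^ (1 / 2 : ℝ) +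
          2 * ∑ c, (z (dyChild P c)) ^ (1 / 2 : ℝ)) := by
        gcongr with P
        exact hP P
    _ = (8 : ℝ≥0∞) ^ (-(k : ℝ) / 2) * ∑ P, (y P) ^ (1 / 2 : ℝ) +
          (8 : ℝ≥0∞) ^ (-((k + 1 : ℕ) : ℝ) / 2) * (2 * ∑ i, (z i) ^ (1 / 2 : ℝ)) := by
        rw [Finset.sum_add_distrib, ← Finset.mul_sum, ← Finset.mul_sum, mul_add, ← mul_assoc, h8,
          ← LevelIncrement.sum_dyLevel_succ k fun i => (z i) ^ (1 / 2 : ℝ)]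
    _ ≤ _ := by gcongr

/-- **The perturbation bound over the half-open cells, `N = n + 1`.** For `L > 0`, a Dirichlet trial
state `Ψ`, `α ∈ ℂ` and a measurable `Ψ₀` with integrable slices and collinear non-negative level-`k+1`
Gram vectors: `A_{k+1}(Ψ) ≤ A_k(Ψ) + 2 (N ∫ |Ψ - α Ψ₀|²)^{1/2}` (per-parent bound, level bookkeeping,
and the Bessel bound `cohSum N L (k+1) W ≤ N ∫ |W|²`). [cite: LSSY2005, §1.2 (1.17)] -/
theorem amplitude_dyMode_succ_le_perturb (hL : 0 < L) (k : ℕ) (Ψ : TrialState (n + 1) L) (α : ℂ)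
    {Ψ₀ : Config (n + 1) → ℂ} {G : Config n → ℂ} (hG : AEStronglyMeasurable G volume)
    (hΨ₀m : Measurable Ψ₀) (hΨ₀i : ∀ Y, Integrable fun x => Ψ₀ (Matrix.vecCons x Y))
    (hΨ₀G : ∀ j : Fin 3 → Fin (2 ^ (k + 1)), ∃ κ : ℝ, 0 ≤ κ ∧
      (fun Y => ∫ x, conj (dyMode L (k + 1) j x) * Ψ₀ (Matrix.vecCons x Y)) = (κ : ℂ) • G) :
    (8 : ℝ≥0∞) ^ (-((k + 1 : ℕ) : ℝ) / 2) *
        ∑ i : Fin 3 → Fin (2 ^ (k + 1)), (occupation (n + 1) (dyMode L (k + 1) i) Ψ.ψ) ^ (1 / 2 : ℝ) ≤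
      (8 : ℝ≥0∞) ^ (-(k : ℝ) / 2) *
          ∑ i : Fin 3 → Fin (2 ^ k), (occupation (n + 1) (dyMode L k i) Ψ.ψ) ^ (1 / 2 : ℝ) +
        2 * (((n + 1 : ℕ) : ℝ≥0∞) *
          ∫⁻ X, (‖Ψ.ψ X - α * Ψ₀ X‖₊ : ℝ≥0∞) ^ 2) ^ (1 / 2 : ℝ) := by
  have hWm : Measurable fun X => Ψ.ψ X - α * Ψ₀ X :=
    Ψ.contDiff.continuous.measurable.sub (hΨ₀m.const_mul α)
  refine (amplitude_succ_le_of_parent_bound k (fun i => occupation (n + 1) (dyMode L (k + 1) i) Ψ.ψ)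
    (fun i => occupation (n + 1) (dyMode L (k + 1) i) fun X => Ψ.ψ X - α * Ψ₀ X)
    (fun P => occupation (n + 1) (dyMode L k P) Ψ.ψ)
    fun P => sum_rpow_half_occupation_dyChild_le hL k P Ψ α hG hΨ₀m hΨ₀i hΨ₀G).trans ?_
  gcongr
  exact cohSum_le_mul_lintegral L (k + 1) hWm

/-- **The perturbation bound over the route's open cubes** (a.e. equal to the half-open cells,
`openCell_ae_eq_dyCell`; `occupation` only sees the mode a.e.), for the free Dirichlet product ground
state `Ψ₀ = 1_{Λ^N} ∏∏ √(2/L) sin(π X_{ik}/L)` (`sin ≥ 0` on `[0, π]`). [cite: LSSY2005, §1.2 (1.17)] -/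
theorem defectPerturbation_openCube {N : ℕ} {L : ℝ} (hL : 0 < L) (Ψ : TrialState N L) (α : ℂ)
    (k : ℕ) :
    (8 : ℝ≥0∞) ^ (-((k + 1 : ℕ) : ℝ) / 2) * ∑ i : Fin 3 → Fin (2 ^ (k + 1)), (occupation N
        (Set.indicator {x : EuclideanSpace ℝ (Fin 3) | ∀ j : Fin 3, x j ∈
          Set.Ioo (((i j : ℕ) : ℝ) * (L / 2 ^ (k + 1))) ((((i j : ℕ) : ℝ) + 1) * (L / 2 ^ (k + 1)))}
        (fun _ => ((Real.sqrt ((L / 2 ^ (k + 1)) ^ 3))⁻¹ : ℂ))) Ψ.ψ) ^ (1 / 2 : ℝ) ≤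
      (8 : ℝ≥0∞) ^ (-(k : ℝ) / 2) * ∑ i : Fin 3 → Fin (2 ^ k), (occupation N (Set.indicator
        {x : EuclideanSpace ℝ (Fin 3) | ∀ j : Fin 3, x j ∈ Set.Ioo (((i j : ℕ) : ℝ) * (L / 2 ^ k))
          ((((i j : ℕ) : ℝ) + 1) * (L / 2 ^ k))}
        (fun _ => ((Real.sqrt ((L / 2 ^ k) ^ 3))⁻¹ : ℂ))) Ψ.ψ) ^ (1 / 2 : ℝ) +
      2 * ((N : ℝ≥0∞) * ∫⁻ X, (‖Ψ.ψ X - α * (boxN N L).indicator (fun X : Config N =>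
          ∏ i : Fin N, ∏ k : Fin 3, ((Real.sqrt (2 / L) * Real.sin (Real.pi * X i k / L) : ℝ) : ℂ))
            X‖₊ : ℝ≥0∞) ^ 2) ^ (1 / 2 : ℝ) := by
  have h : ∀ (k : ℕ) (i : Fin 3 → Fin (2 ^ k)), occupation N (Set.indicator
        {x : EuclideanSpace ℝ (Fin 3) | ∀ j : Fin 3, x j ∈ Set.Ioo (((i j : ℕ) : ℝ) * (L / 2 ^ k))
          ((((i j : ℕ) : ℝ) + 1) * (L / 2 ^ k))}
        (fun _ => ((Real.sqrt ((L / 2 ^ k) ^ 3))⁻¹ : ℂ))) Ψ.ψ = occupation N (dyMode L k i) Ψ.ψ :=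
    fun k i => occupation_congr_ae (indicator_ae_eq_of_ae_eq_set
      (CoherentAmplitudeMonotone.openCell_ae_eq_dyCell L k i)) Ψ.ψ
  simp only [h]
  cases N with
  | zero => simp [occupation]
  | succ n =>
    have hχ0 : ∀ t ∈ Set.Ioo 0 L, 0 ≤ Real.sqrt (2 / L) * Real.sin (Real.pi * t / L) := fun t ht => by
      refine mul_nonneg (Real.sqrt_nonneg _) (Real.sin_nonneg_of_nonneg_of_le_pi
        (div_nonneg (mul_nonneg Real.pi_pos.le ht.1.le) hL.le) ?_)
      rw [mul_div_assoc]
      exact mul_le_of_le_one_right Real.pi_pos.le ((div_le_one hL).2 ht.2.le)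
    obtain ⟨hG, hΨ₀m, hΨ₀i, hΨ₀G⟩ := prodState_gram (n := n) L
      (χ := fun t => Real.sqrt (2 / L) * Real.sin (Real.pi * t / L)) (by fun_prop) hχ0 (k + 1)
    exact amplitude_dyMode_succ_le_perturb hL k Ψ α hG hΨ₀m hΨ₀i hΨ₀G

end DefectPerturbation

/-- **Stub DP: perturbation of the coherence defect** (`DefectPerturbation`). For every `N`, `L > 0`,
every Dirichlet trial state `Ψ ∈ TrialState N L`, every `α ∈ ℂ` and every level `m ≥ 1`:
`A_m(Ψ) ≤ A_{m-1}(Ψ) + 2 (N ∫ |Ψ - α Ψ₀|²)^{1/2}`, where `A_m = 8^{-m/2} ∑_i ⟨φ_{m,i}, γ_Ψ φ_{m,i}⟩^{1/2}`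
is the coherent amplitude over the flat modes of the `8^m` open dyadic cubes of side `L/2^m` and
`Ψ₀ = 1_{Λ^N} ∏_i ∏_k √(2/L) sin(π X_{ik}/L)` the free Dirichlet product ground state — the Gram
vectors are linear in `Ψ`, those of `Ψ₀` are non-negative multiples of one function, triangle
inequality in `L²(dY)`, Bessel. [cite: LSSY2005, §1.2 (1.17)] -/
theorem stub_defectPerturbation :
    ∀ (N : ℕ) (L : ℝ), 0 < L → ∀ (Ψ : TrialState N L) (α : ℂ) (m : ℕ), 1 ≤ m →
      let Ψ₀ : Config N → ℂ := fun X => (boxN N L).indicator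
        (fun X => ∏ i : Fin N, ∏ k : Fin 3, ((Real.sqrt (2 / L) * Real.sin (Real.pi * X i k / L) : ℝ) : ℂ)) X
      let φ : (m : ℕ) → (Fin 3 → Fin (2 ^ m)) → EuclideanSpace ℝ (Fin 3) → ℂ := fun m i =>
        Set.indicator {x : EuclideanSpace ℝ (Fin 3) | ∀ k : Fin 3, x k ∈
            Set.Ioo (((i k : ℕ) : ℝ) * (L / 2 ^ m)) ((((i k : ℕ) : ℝ) + 1) * (L / 2 ^ m))}
          (fun _ => ((Real.sqrt ((L / 2 ^ m) ^ 3))⁻¹ : ℂ))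
      let A : ℕ → ℝ≥0∞ := fun m => (8 : ℝ≥0∞) ^ (-(m : ℝ) / 2) *
        ∑ i : Fin 3 → Fin (2 ^ m), (occupation N (φ m i) Ψ.ψ) ^ (1 / 2 : ℝ)
      A m ≤ A (m - 1) + 2 * ((N : ℝ≥0∞) * ∫⁻ X, (‖Ψ.ψ X - α * Ψ₀ X‖₊ : ℝ≥0∞) ^ 2) ^ (1 / 2 : ℝ) := by
  intro N L hL Ψ α m hm
  obtain ⟨k, rfl⟩ : ∃ k, m = k + 1 := ⟨m - 1, by omega⟩
  exact DefectPerturbation.defectPerturbation_openCube hL Ψ α k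

end Summit.AtomisticToContinuum.BoseEinsteinCondensation.Cruxes.DyadicCoherenceDefect.Birth

end
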